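import Literature.AlgebraicGeometry.CossartPiltant200819.Ramification2008
import HarnessLib

/-!
# Cossart–Piltant 2008 in its printed characteristic: Prop 8.1 and Prop 9.3 over a field of
# characteristic `p > 0` (repair record R-CP2008-CHARP)

Topic: `Literature/AlgebraicGeometry/CossartPiltant200819`. V. Cossart, O. Piltant, *Resolution of
singularities of threefolds in positive characteristic I. Reduction to local uniformization on
Artin–Schreier and purely inseparable coverings*, J. Algebra 320 (2008) 1051–1082 (`CossartPiltant2008`;
held text = the manuscript hal-00139124, `paper:doi-10-1016-j-jalgebra-2008-03-032`, "HAL p. N" = its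
pages) fixes at the head of §3 (HAL p. 5, lines 8–9): "From now on up to the end of this article, `k`
denotes any field of characteristic `p > 0`." The pre-campaign modules `Threefolds2008.lean` and
`Ramification2008.lean` type the statements of §§4–9 `∀ (k : Type u) [Field k]`, i.e. for a ground field
of ANY characteristic. This module is the repair record (FACT desk object R-CP2008-CHARP, FACT-LIST §E-bis
rows 1–3; shape = res-lit-6's pre-read `R-CP2008-CHARP-PREREAD.md` 91c59423a0ef1ca5 as adopted by the desk):

* **(B) print-exact siblings** for the two statements whose characteristic-free form is NOT backed by a
  characteristic-free theorem of the tree: `MonomialUniformizationCharP p` (Prop 8.1, HAL p. 22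
  lines 36–47) and `DescentBelowInertiaFieldCharP p` (Prop 9.3, HAL p. 27 lines 43–50). Their bodies are
  those of `MonomialUniformization` / `DescentBelowInertiaField` (`Ramification2008.lean` :137 / :184,
  sha16 ab9b9c0105732675) with the single addition of the binder `[CharP k p]` after `[Field k]`, for a
  prime `p` given as `(p : ℕ) [Fact p.Prime]`. The one-line PROVED edges `monomialUniformizationCharP_of`
  and `descentBelowInertiaFieldCharP_of` specialise the characteristic-free facts to them. Consumers of
  Prop 8.1 / Prop 9.3 (`PrimaryContraction2008`, `Prop93Radical2008`, `ArcDescentCore2008`,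
  `DiscreteDescent2008`, `TamePrimeDescentAssembly2008`, …) may migrate to the siblings at leisure; the
  frozen files are untouched.
* **(A) backing table** for the six statements whose characteristic-free typed form IS a theorem of the
  tree modulo characteristic-free LIVE facts (so that only their `[cite]` under-describes the
  provenance; no sibling, no consumer re-derivation):

  | decl (file:line) | print (HAL) | char-free form = tree theorem via | modulo (char-free fact) |
  |---|---|---|---|
  | `RefinedPatching` (Threefolds2008.lean:136) | Prop 4.9 | `refinedPatching_of_general` (AffineModels2019.lean:83); also `refinedPatching_of_props47And48_of_principalization` (Prop48RegularCentres2008.lean:685) | `Resolution.CossartPiltant2019General` (QuasiExcellentSchemes.lean:116, CP 2019 Thm 1.1) + `Resolution.Stacks07QW_field` (ExcellentRings.lean:238) |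
  | `RankReduction` (Threefolds2008.lean:154) | Prop 5.1 | `rankReduction_of_cjs` (RankReduction2008.lean:481); `rankReduction_of_cossartPiltant2019LU3` (Bridge2019.lean:238) | `Resolution.CossartJannsenSaito2020General` (QuasiExcellentSchemes.lean:130, CJS Thm 1.2) / `Resolution.CossartPiltant2019LU3` (ArithmeticalThreefolds.lean:237, "for every field `k`, of any characteristic") |
  | `ClimbToInertiaField` (Ramification2008.lean:113) | Cor 6.3 | `climbToInertiaField_of_cossartPiltant2019LU3` (Bridge2019.lean:204); `climbToInertiaField_of_cofinality` (ClimbToInertiaField2008.lean:158) | `Resolution.CossartPiltant2019LU3`; `Cofinality` |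
  | `PrimeDegreeAscent` (Ramification2008.lean:165) | Prop 8.3 | `primeDegreeAscent_of_cossartPiltant2019LU3` (Bridge2019.lean:216) | `Resolution.CossartPiltant2019LU3` |
  | `TamePrimeDescent` (Ramification2008.lean:217) | Lemma 9.4 | `tamePrimeDescent_of_cossartPiltant2019LU3` (Bridge2019.lean:225) | `Resolution.CossartPiltant2019LU3` |
  | `DescentBelowRamificationField` (Ramification2008.lean:234) | Prop 9.5 | `descentBelowRamificationField_of_cossartPiltant2019LU3` (Bridge2019.lean:231); `descentBelowRamificationField_of_leaves` (RamificationDescent2008.lean:329) | `Resolution.CossartPiltant2019LU3`; (`ClimbToInertiaField`, …) |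

  For each of these six: print scope = `k` of characteristic `p > 0` (HAL p. 5 l. 8–9, §§3–9); typed for
  every field; the characteristic-free statement is a THEOREM of the tree modulo the characteristic-free
  fact in the last column, via the edge in the third column.

Nothing here asserts or refutes any statement of `CossartPiltant2008` / `CossartPiltant2019`; the two new
`Prop`s are cited statements (users take `(h : MonomialUniformizationCharP p)`), net +2 named facts
authorised as a pre-campaign repair (FACT desk word 2026-08-27, F-20g `_reg` precedent).

## References

* V. Cossart, O. Piltant, J. Algebra 320 (2008) 1051–1082 = hal-00139124: §3 p. 5 l. 8–9 (standing
  characteristic); Prop 8.1 (HAL p. 22); Prop 9.3 (HAL p. 27). [CossartPiltant2008]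
-/

noncomputable section

namespace Literature.AlgebraicGeometry.CossartPiltant200819.CP2008

open Literature.AlgebraicGeometry.Resolution

universe u

/-- **Cossart–Piltant 2008, Proposition 8.1, in the printed characteristic** (HAL p. 22, lines 36–47;
= journal Prop 6.2), VERBATIM: "Let `L/k` be a function field of transcendence degree three and `W/k`
be a `k`-valuation ring of `L` with `QF(W) = L`, of rank one, rational rank `r` (`1 ≤ r ≤ 3`) and such
that `κ(W)/k` is algebraic. Let `S₀` be a given normal local model of `W/k` and `f₀ ∈ S₀`, `f₀ ≠ 0`.
Assume that there exists a local uniformization of `W/k`. There exists `f ∈ m_{S₀}`, `f ≠ 0`, such that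
`f₀ | f`, and a local uniformization `S` of `W/k` with r.s.p. `(x₁, x₂, x₃)` having the following
properties: (1) `S₀ < S` and `(S₀)_f = S_f`. (2) `√(fS) = √(m_{S₀}S) = (x₁⋯x_r)` and `W x₁, …, W x_r`
are linearly independent in `W_L ⊗_ℤ ℚ`." — with the standing assumption of §3 (HAL p. 5, l. 8–9):
"`k` denotes any field of characteristic `p > 0`", rendered by the binder `[CharP k p]` for a prime `p`.
The body is otherwise token-identical to `MonomialUniformization` (rendering notes there). Users take
`(h : MonomialUniformizationCharP p)`. [cite: CossartPiltant2008, Prop 8.1 (HAL p. 22)] -/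
def MonomialUniformizationCharP (p : ℕ) [Fact p.Prime] : Prop :=
  ∀ (k L : Type u) [Field k] [CharP k p] [Field L] [Algebra k L], (⊤ : IntermediateField k L).FG →
    Algebra.trdeg k L = 3 →
    ∀ (W : ValuationSubring L) (hk : ∀ c : k, algebraMap k L c ∈ W), Nonempty W.valuation.RankOne →
      ∀ (r : ℕ) (hr : r ≤ 3), 1 ≤ r → ratRank W = r → residueTrdeg k W hk = 0 →
      ∀ S₀ : Subalgebra k L, IsNormalLocalModelOf k L W S₀ → ∀ f₀ : L, f₀ ∈ S₀ → f₀ ≠ 0 →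
        IsLocallyUniformizable k L W →
        ∃ f : L, f ∈ S₀ ∧ W.valuation f < 1 ∧ f ≠ 0 ∧ (∃ c ∈ S₀, f = f₀ * c) ∧
          ∃ (S : Subalgebra k L) (x : Fin 3 → L), IsLocalUniformizationOf k L W S ∧
            (∀ i, x i ∈ S ∧ W.valuation (x i) < 1) ∧
            (∀ s ∈ S, W.valuation s < 1 → ∃ a : Fin 3 → L, (∀ i, a i ∈ S) ∧ s = ∑ i, a i * x i) ∧
            S₀ ≤ S ∧
            {y : L | ∃ a ∈ S₀, ∃ n : ℕ, y = a * (f ^ n)⁻¹} =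
              {y : L | ∃ a ∈ S, ∃ n : ℕ, y = a * (f ^ n)⁻¹} ∧
            (∀ s ∈ S, (∃ n : ℕ, 0 < n ∧ ∃ a ∈ S, s ^ n = a * f) ↔
              (∃ a ∈ S, s = a * ∏ i : Fin r, x (Fin.castLE hr i))) ∧
            (∀ s ∈ S₀, W.valuation s < 1 → ∃ a ∈ S, s = a * ∏ i : Fin r, x (Fin.castLE hr i)) ∧
            QIndepValues W (fun i : Fin r => x (Fin.castLE hr i))

/-- **PROVED edge**: the characteristic-free fact `MonomialUniformization` specialises to the printed
characteristic. [cite: CossartPiltant2008, Prop 8.1 (HAL p. 22)] -/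
theorem monomialUniformizationCharP_of (h : MonomialUniformization.{u}) (p : ℕ) [Fact p.Prime] :
    MonomialUniformizationCharP.{u} p :=
  fun k L _ _ _ _ => h k L

/-- **Cossart–Piltant 2008, Proposition 9.3, in the printed characteristic** (HAL p. 27, lines 43–50;
= journal Prop 9.1), VERBATIM: "Let `L/K` be a Galois extension of function fields of transcendence
degree three over `k` and let `W/k` be a `k`-valuation ring of rank one such that `QF(W) = L` and
`κ(W)/k` is algebraic. Let `V := W ∩ K`. Let `K'`, `K ⊆ K' ⊆ L` be an intermediate extension such that
`K'` is contained in `K^i`, the inertia field of `W` over `V`. Let `V' := W ∩ K'`. Assume that `V'/k`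
has a local uniformization `S'₀`. There exists a local uniformization `S'` of `V'/k`, with `S'₀ < S'`,
and a local uniformization `R` of `V/k` lying below `S'`." — with the standing assumption of §3 (HAL
p. 5, l. 8–9): "`k` denotes any field of characteristic `p > 0`", rendered by the binder `[CharP k p]` for
a prime `p`. The body is otherwise token-identical to `DescentBelowInertiaField`. Users take
`(h : DescentBelowInertiaFieldCharP p)`. [cite: CossartPiltant2008, Prop 9.3 (HAL p. 27)] -/
def DescentBelowInertiaFieldCharP (p : ℕ) [Fact p.Prime] : Prop :=
  ∀ (k K : Type u) [Field k] [CharP k p] [Field K] [Algebra k K], (⊤ : IntermediateField k K).FG →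
    Algebra.trdeg k K = 3 →
    ∀ (L : Type u) [Field L] [Algebra K L] [Algebra k L] [IsScalarTower k K L],
      FiniteDimensional K L → IsGalois K L →
      ∀ (W : ValuationSubring L) (hk : ∀ c : k, algebraMap k L c ∈ W),
        Nonempty W.valuation.RankOne → residueTrdeg k W hk = 0 →
        ∀ K' : IntermediateField K L, LeInertiaField K W K' →
          ∀ S₀ : Subalgebra k K', IsLocalUniformizationOf k K' (W.comap (algebraMap K' L)) S₀ →
            ∃ S : Subalgebra k K', IsLocalUniformizationOf k K' (W.comap (algebraMap K' L)) S ∧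
              S₀ ≤ S ∧ ∃ R : Subalgebra k K,
                IsLocalUniformizationOf k K (W.comap (algebraMap K L)) R ∧ LiesBelow W R K' S

/-- **PROVED edge**: the characteristic-free fact `DescentBelowInertiaField` specialises to the printed
characteristic. [cite: CossartPiltant2008, Prop 9.3 (HAL p. 27)] -/
theorem descentBelowInertiaFieldCharP_of (h : DescentBelowInertiaField.{u}) (p : ℕ) [Fact p.Prime] :
    DescentBelowInertiaFieldCharP.{u} p :=
  fun k K _ _ _ _ => h k K

end Literature.AlgebraicGeometry.CossartPiltant200819.CP2008

end
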